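import Summits.QuantumFields.BalabanUV.Beta.GAN24.DerivativeRateTransferJensenMassFreeCoercive
import Summits.QuantumFields.BalabanUV.Beta.GAN24.DerivativeRateTransferLoewnerGramMass
import Summits.QuantumFields.BalabanUV.Beta.GAN24.DerivativeRateTransferLoewnerGramMassLattice
import Summits.QuantumFields.BalabanUV.Beta.GAN24.DerivativeRateTransferLoewnerKKTCoercive

/-!
# `BalabanUV.Beta.GAN24.DerivativeRateTransferLoewnerGramMassLatticeEnd` — binder row G-an2-4 ∕ (CONV-C), route R6 «VALUES, NOT DERIVATIVES», PART 98:
# THE ONE-STEP GRAM LETTER ON THE BLOCK LATTICE IS A PURE LATTICE CONSTANT — PART 95's `hN` reduction fed by PART 93's coercivity constant, PART 97's three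
# lattice letters and PART 102's `hk` ∕ size-of-`𝒮` from the same reference fields: for the carrier `(w_c d′)•QᵀQ` of PART 56,
# `|(ℋᵀGℋ)_{ab}| ≤ w_c d′(L^d)⁻¹·(4(2·w_f′·4d·L^d)·4(d(L−1))²∕((L^d)⁻¹w_f) + 2L^d)` — NO hypothesis on `𝒮`, NO `hk`
# (unit b2b-balaban-gan24-p3, gen 48; v1)

NOT IN PRINT; OUR PROOF (for the ROUTE; PART 93 `coercive_lattice`, PART 95 `abs_gram_minOp_le_of_coercive`, PART 97 `mulVec_Q_blockRef` ∕ `dotProduct_self_blockRef` ∕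
`form_blockGram_le` ∕ `posSemidef_blockGram` ∕ `form_blockRef_le`, PART 102 `isUnit_kkt_det_of_coercive` ∕ `effForm_diag_le_of_reference` BY NAME).  HONEST FRAMING (cell contract,
verbatim): «discharging `BetaPertH` makes Bałaban's UV stability UNCONDITIONAL — a real constructive-QFT result; it is NOT the continuum limit and NOT the Clay
problem.»  HONEST DEPENDENCY (verbatim): «continuum YM on T⁴ ⇐ BetaPertH ∧ nine spine estimates (0/9 proved); BetaPertH ⇐ (D1) ∧ (D4) ∧ CAP+tail; G-an2-4 gates
asym, D1 and NE2/3/4.»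

WHAT THIS FILE PROVES (0 sorry, 0 `def`, nothing cited): **`abs_gram_blockLattice_le`** — on the block lattice of PARTs 24 ∕ 64 ∕ 85 ∕ 93 (comb block transporters
`W`, transported averaging `Q`, orthogonal bond transporters `R`), for a PSD fine form `H_f` with the TWO-SIDED comparability
`w_f·Σ_e|R_eu(tgt e) − u(src e)|² ≤ ⟨u,H_fu⟩ ≤ w_f′·Σ_e|…|²` (`0 < w_f`, `0 ≤ w_f′`, `2 ≤ L`, `1 ≤ d`): (1) the bordered matrix `kkt H_f Q` IS nonsingular (PART 102), and
(2) `|(ℋᵀ((w_c d′)•QᵀQ)ℋ)_{ab}| ≤ (w_c d′(L^d)⁻¹)·(4(2·w_f′(4d·L^d))∕γ + 2L^d)`, `γ = (L^d)⁻¹w_f∕(4(d(L−1))²)` — the Gram letter `N` of PART 20 ∕ 56's two-level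
END at ONE step as a PURE LATTICE CONSTANT: no (H2)-class input, no hypothesis on `𝒮` (its diagonal is below the reference energy), no `hk`.  WHAT IT DOES NOT DO: the tower (re-indexing, growth `Λ`); (CONS); the mismatch letter.  SUPPLIER work on route C-R6°
(rank 2, REDUCTION); no consumer of record; NEVER «G-an2-4 closed»; NOT (CONV-C), NOT D1, NOT `BetaPertH`, NOT continuum, NOT Clay.  Records:
`HOME/b2b-balaban-gan24-p3/gen48/R6-LEDGER-NOTE.md`, `…/gen48/README.md`.
-/

noncomputable section

open Matrix Finset Function

namespace Summit.QuantumFields.BalabanUV.Beta.GAN24.DerivativeRateTransferLoewnerGramMassLatticeEnd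

open Literature.MathematicalPhysics.QuantumFieldTheory.Balaban1983to89.Beta.Composition (kkt)
open Literature.MathematicalPhysics.QuantumFieldTheory.Balaban1983to89.Beta.CompositionSingular (effForm minOp)
open Summit.QuantumFields.BalabanUV.Beta.GAN24.DerivativeRateTransferJensenMassFreeCoercive (coercive_lattice)
open Summit.QuantumFields.BalabanUV.Beta.GAN24.DerivativeRateTransferLoewnerGramMass (abs_gram_minOp_le_of_coercive)
open Summit.QuantumFields.BalabanUV.Beta.GAN24.DerivativeRateTransferLoewnerGramMassLattice (mulVec_Q_blockRef dotProduct_self_blockRef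
  form_blockGram_le posSemidef_blockGram form_blockRef_le)
open Summit.QuantumFields.BalabanUV.Beta.GAN24.DerivativeRateTransferLoewnerKKTCoercive (isUnit_kkt_det_of_coercive effForm_diag_le_of_reference)

variable {d L M : ℕ} {o : Type*} [Fintype o] [DecidableEq o]

/-- **`abs_gram_blockLattice_le` — THE ONE-STEP GRAM LETTER ON THE BLOCK LATTICE, EXPLICIT** [our proof; PART 93 + PART 95 + PART 97]. -/
theorem abs_gram_blockLattice_le [NeZero M] (hL : 0 < L) (hL2 : 2 ≤ L) (hd : 1 ≤ d)
    {R : ((Fin d → ZMod M) × (Fin d → Fin L)) × Fin d → Matrix o o ℝ} (hR : ∀ e, (R e)ᵀ * R e = 1)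
    {W : (Fin d → ZMod M) → (Fin d → ZMod M) × (Fin d → Fin L) → Matrix o o ℝ} (hW : ∀ y x, (W y x)ᵀ * W y x = 1)
    (hWstep : ∀ (y : Fin d → ZMod M) (z : Fin d → Fin L) (μ : Fin d) (h : (z μ : ℕ) + 1 < L), (∀ ν, μ < ν → (z ν : ℕ) = 0) →
      W y (y, update z μ ⟨(z μ : ℕ) + 1, h⟩) = W y (y, z) * R ((y, z), μ))
    {Q : Matrix ((Fin d → ZMod M) × o) (((Fin d → ZMod M) × (Fin d → Fin L)) × o) ℝ}
    (hQ : ∀ (u : ((Fin d → ZMod M) × (Fin d → Fin L)) × o → ℝ) (y : Fin d → ZMod M),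
      (fun a => (Q *ᵥ u) (y, a)) =
        ∑ x, (if x.1 = y then ((L : ℝ) ^ d)⁻¹ else 0) • (W y x *ᵥ fun b => u (x, b)))
    {Hf : Matrix (((Fin d → ZMod M) × (Fin d → Fin L)) × o) (((Fin d → ZMod M) × (Fin d → Fin L)) × o) ℝ}
    (hHfp : Hf.PosSemidef) {wf wf' wc d' : ℝ} (hwf : 0 < wf) (hwf' : 0 ≤ wf') (hwc : 0 ≤ wc) (hd' : 0 ≤ d')
    (hHf : ∀ u : ((Fin d → ZMod M) × (Fin d → Fin L)) × o → ℝ,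
      wf * ∑ e : ((Fin d → ZMod M) × (Fin d → Fin L)) × Fin d,
        ((R e *ᵥ fun b => u ((e.1.1 + ((((e.1.2 e.2 : ℕ) + 1) / L) • (Pi.single e.2 (1 : ZMod M))),
            update e.1.2 e.2 ⟨((e.1.2 e.2 : ℕ) + 1) % L, Nat.mod_lt _ hL⟩), b)) - fun b => u (e.1, b)) ⬝ᵥ
          ((R e *ᵥ fun b => u ((e.1.1 + ((((e.1.2 e.2 : ℕ) + 1) / L) • (Pi.single e.2 (1 : ZMod M))),
            update e.1.2 e.2 ⟨((e.1.2 e.2 : ℕ) + 1) % L, Nat.mod_lt _ hL⟩), b)) - fun b => u (e.1, b)) ≤ u ⬝ᵥ (Hf *ᵥ u))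
    (hHf' : ∀ u : ((Fin d → ZMod M) × (Fin d → Fin L)) × o → ℝ, u ⬝ᵥ (Hf *ᵥ u) ≤
      wf' * ∑ e : ((Fin d → ZMod M) × (Fin d → Fin L)) × Fin d,
        ((R e *ᵥ fun b => u ((e.1.1 + ((((e.1.2 e.2 : ℕ) + 1) / L) • (Pi.single e.2 (1 : ZMod M))),
            update e.1.2 e.2 ⟨((e.1.2 e.2 : ℕ) + 1) % L, Nat.mod_lt _ hL⟩), b)) - fun b => u (e.1, b)) ⬝ᵥ
          ((R e *ᵥ fun b => u ((e.1.1 + ((((e.1.2 e.2 : ℕ) + 1) / L) • (Pi.single e.2 (1 : ZMod M))),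
            update e.1.2 e.2 ⟨((e.1.2 e.2 : ℕ) + 1) % L, Nat.mod_lt _ hL⟩), b)) - fun b => u (e.1, b))) :
    IsUnit (kkt Hf Q).det ∧
    ∀ a b, |((minOp Hf Q)ᵀ * ((wc * d') • (Qᵀ * Q)) * minOp Hf Q) a b| ≤
      (wc * d' * ((L : ℝ) ^ d)⁻¹) *
        (4 * (wf' * (4 * d * (L : ℝ) ^ d) + wf' * (4 * d * (L : ℝ) ^ d)) / ((((L : ℝ) ^ d)⁻¹ * wf) / (4 * (d * ((L : ℝ) - 1)) ^ 2)) +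
          2 * (L : ℝ) ^ d) := by
  haveI : NeZero L := ⟨hL.ne'⟩
  have hdL : 0 < 4 * (d * ((L : ℝ) - 1)) ^ 2 := by
    have h1 : (1 : ℝ) ≤ d := by exact_mod_cast hd
    have h2 : (2 : ℝ) ≤ L := by exact_mod_cast hL2
    have : 0 < d * ((L : ℝ) - 1) := mul_pos (by linarith) (by linarith)
    positivity
  have hLd : 0 < ((L : ℝ) ^ d)⁻¹ := inv_pos.mpr (pow_pos (by exact_mod_cast hL) d)
  have hγ : 0 < (((L : ℝ) ^ d)⁻¹ * wf) / (4 * (d * ((L : ℝ) - 1)) ^ 2) := div_pos (mul_pos hLd hwf) hdL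
  -- coercivity on `ker Q` (PART 93), with the constant moved across
  have hcoer : ∀ z : ((Fin d → ZMod M) × (Fin d → Fin L)) × o → ℝ, Q *ᵥ z = 0 →
      (((L : ℝ) ^ d)⁻¹ * wf) / (4 * (d * ((L : ℝ) - 1)) ^ 2) * (z ⬝ᵥ z) ≤ z ⬝ᵥ (Hf *ᵥ z) := fun z hz => by
    have h := coercive_lattice hL hW hWstep hQ hwf.le hHf z hz
    rw [div_mul_eq_mul_div, div_le_iff₀ hdL]
    linarith
  -- the reference fields (PART 97), the bordered matrix (PART 102), the size of `𝒮` from the same fields (PART 102)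
  have hr : ∀ ya : (Fin d → ZMod M) × o, Q *ᵥ (fun p : ((Fin d → ZMod M) × (Fin d → Fin L)) × o =>
      if p.1.1 = ya.1 then ((W ya.1 p.1)ᵀ *ᵥ Pi.single ya.2 (1 : ℝ)) p.2 else 0) = Pi.single ya 1 := fun ya => by
    obtain ⟨y₀, a₀⟩ := ya; exact mulVec_Q_blockRef hW hQ y₀ a₀
  have hk : IsUnit (kkt Hf Q).det := isUnit_kkt_det_of_coercive hγ hcoer _ hr
  have hE : ∀ ya : (Fin d → ZMod M) × o, (fun p : ((Fin d → ZMod M) × (Fin d → Fin L)) × o =>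
      if p.1.1 = ya.1 then ((W ya.1 p.1)ᵀ *ᵥ Pi.single ya.2 (1 : ℝ)) p.2 else 0) ⬝ᵥ (Hf *ᵥ fun p : ((Fin d → ZMod M) × (Fin d → Fin L)) × o =>
      if p.1.1 = ya.1 then ((W ya.1 p.1)ᵀ *ᵥ Pi.single ya.2 (1 : ℝ)) p.2 else 0) ≤ wf' * (4 * d * (L : ℝ) ^ d) := fun ya => by
    obtain ⟨y₀, a₀⟩ := ya; exact form_blockRef_le hL hR hW hwf' hHf' y₀ a₀
  refine ⟨hk, ?_⟩
  exact abs_gram_minOp_le_of_coercive hHfp hk (posSemidef_blockGram Q (mul_nonneg hwc hd')) (mul_nonneg (mul_nonneg hwc hd') hLd.le) hγ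
    (fun v => form_blockGram_le hW hQ (mul_nonneg hwc hd') v) hcoer
    (fun (ya : (Fin d → ZMod M) × o) (p : ((Fin d → ZMod M) × (Fin d → Fin L)) × o) =>
      if p.1.1 = ya.1 then ((W ya.1 p.1)ᵀ *ᵥ Pi.single ya.2 (1 : ℝ)) p.2 else 0)
    hr hE (fun ya => by obtain ⟨y₀, a₀⟩ := ya; exact (dotProduct_self_blockRef hW y₀ a₀).le)
    (fun a => (effForm_diag_le_of_reference hHfp hk (hr a)).trans (hE a))

end Summit.QuantumFields.BalabanUV.Beta.GAN24.DerivativeRateTransferLoewnerGramMassLatticeEnd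

end
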